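import Mathlib
import Literature.MathematicalPhysics.QuantumFieldTheory.Balaban1983to89.B12MomentSums434

/-!
# B12 [Balaban1987RG1] — the p. 290/291 CHAIN «after all the changes and resummations» for the coefficient
# kernels of (4.34): replacement H_j(□₀) → H_j, y-extension supp ζ̃_□ → Z⁴, X-extension X ⊂ □̃² → 𝐃⁰_j,
# as ONE kernel inequality (bookkeeping capstone of `B12HjFree290`, `B12Cubes436`, `B12MomentSums434`)

Bałaban, *Renormalization group approach to lattice gauge field theories. I. Generation of effective actions
in a small field approximation and a coupling constant renormalization in four dimensions*, Commun. Math.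
Phys. **109** (1987) 249–301 [Balaban1987RG1] (PDF page = journal page − 248), §4 pp. 289–291; (5.10) p. 293.

CITATION HEADER (quotations verbatim from the renders `1987-cmp109-rg-I-small-field-p042-x2.png` (p. 290) and
`-p043-x2.png` (p. 291), both read as images by this seat; «…» marks an elision):

* p. 290 [PDF 42] — «The sums over x above are restricted to supp δB ⊂ □, and the sums over y are restricted to
  supp B ⊂ supp ζ̃_□.» … «If we replace H_j(□₀) by H_j with free boundary conditions, then the difference
  H_j(□₀) − H_j restricted to X × supp ζ̃_□, yields the factor B₀ exp(−δ₀M(Lʲη)⁻¹) in a bound of the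
  corresponding expression. Thus this change increases the sum of the irrelevant terms by the expression of the
  form (4.34), but with very small coefficients. Next, we extend summations over y to the whole lattice Z⁴. The
  difference between the sum over supp ζ̃_□ and the sum over Z⁴ is a sum over a subset of (□̃³)ᶜ∩Z⁴. This gives
  again the exponentially small coefficients. Finally, the crucial step is an extension of the sum over
  localization domains X. In this section we consider the expressions with the localization domains X satisfying
  the condition X ⊂ □̃², for a given cube □. «…» We extend it to all X ∈ 𝐃⁰_j, where 𝐃⁰_j is the class of
  localization domains constructed for the lattice ξZ⁴. «…» This means that we sum the function 𝐄⁽²⁾(X) over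
  X ∈ 𝐃⁰_j, because the other expressions do not depend on X. The difference between the two sums gives a
  function satisfying the following inequality
  |Σ_{X∈𝐃⁰_j, X∩(□̃²)ᶜ≠∅} 𝐄⁽²⁾_{μ,ν}(X, x, y)| ≤ O(1)E₀ exp(−(Lʲη)⁻¹) exp(−δ₁|x − y|), for x ∈ □, (4.36)
  hence, substituting it into (4.34), we get an irrelevant expression again.»
* p. 291 [PDF 43] — «Thus, after all the changes and resummations, we obtain an expression which is equal to this
  in (4.34), with the function 𝐄⁽²⁾_{μ,ν}(X, x, y) replaced by  Π_{μ,ν}(x, y) = Σ_{X∈𝐃⁰_j} 𝐄⁽²⁾_{μ,ν}(X, x, y), (4.37)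
  and the irrelevant terms resummed over X ∈ 𝐃_j, X ⊂ □̃². The function Π is called the vacuum polarization
  tensor.»

WHY THIS MODULE.  The three p. 290 changes were certified ONE AT A TIME by the lineage, each as a bound on the
corresponding error for a (4.34) coefficient kernel `Σ_y K(x,y) w(y)` (weight `|w(y)| ≤ K_w pw_p(x − y)`; the
monomials `1`, `(y_κ − x_κ)`, `(y_κ − x_κ)(y_λ − x_λ)` are `p = 0, 1, 2`, `K_w = 1`):
(i) the replacement H_j(□₀) → H_j — the S×S-restricted difference kernel obeys the kernel bound with
`C_E = 8E₀α₂⁻²B₃η` (`B12HjFree290.kernelBound_restr_sub`), hence its (4.34) coefficients are `∝ η`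
(`B12MomentSums434.coeff434_restr_sub`); (ii) the y-extension — the tail of a two-point-bounded, NOT translation
invariant kernel over `y ∉ supp ζ̃_□ ⊇ □̃³` is `≤ A K_w e^{−(δ₁/2)·3R₀} S_{δ₁/2,p,d}` (`B12MomentSums434.tail434_latt`,
`B12Cubes436.mem_suppZeta_of_l1_lt`); (iii) the X-extension — (4.36) for print's regions
(`B12Cubes436.ineq436_box_l1`) and «because the other expressions do not depend on X»
(`B12MomentSums434.fubini434`).  What was NOT in the tree is the sentence of p. 291 itself: that the expression
one STARTS from — kernel of H_j(□₀), X ⊂ □̃², y ∈ supp ζ̃_□ — and the expression one ENDS with — the kernel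
Π(x,y) = Σ_{X∈𝐃⁰_j} 𝐄²(X,x,y) of (4.37) with the H_j-kernel and y ∈ Z⁴ — differ, coefficient kernel by coefficient
kernel and uniformly in x ∈ □, by AT MOST THE SUM of the three certified error terms.  This module proves that
chain as one inequality (a three-term triangle inequality over absolutely convergent rearrangements), so that the
p. 290/291 passage is kernel-checked end to end as bookkeeping, every analytic input remaining a NAMED HYPOTHESIS
of the parents.

WHAT THIS MODULE PROVES ([folklore] real analysis on ℤᵈ, or chaining of lineage capstones; site lattice ℤᵈ in
ξ-units, cubes of π_j of side `M ≥ 1` sites, `d ≥ 1`, ℓ¹ metric, `δ₁ = ½ min{δ₀, κ(Md)⁻¹}` = `B12Decay510.delta1`,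
constants `S_{a,p,d}` of `B12WholeLattice290`, `K₀` of `B12TreeDecay`, `K₁` of `B12Decay510Window`):
* §1 [folklore]: an absolutely convergent X-sum splits over two complementary sub-classes
  (`tsum_eq_tsum_compl_add_tsum`); a finite weighted y-sum commutes with an absolutely convergent X-sum
  (`tsum_finsetSum_mul`); on `S × S` the restricted difference kernel IS the difference (`indicator_sub_of_mem`).
* §2 the three error terms, each with the summability of every series it mentions:
  `replacement_error` — for `x ∈ S`, a finite y-range `Y ⊆ S` and any sub-class `{X : P X}` of 𝐃⁰_j(ℤᵈ):
  `|Σ'_{X:P} Σ_{y∈Y} 𝐄²₀(X,x,y)w(y) − Σ'_{X:P} Σ_{y∈Y} 𝐄²(X,x,y)w(y)| ≤ (8E₀α₂⁻²B₃η) e^{3Mdδ₁}K₀K₁(d,δ₀/2) K_w S_{δ₁,p,d}`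
  (κ ≥ 2κ₀(4·2ᵈ,2d)); `yext_error` — under a kernel bound `KernelBound E2 C_E κ δ₀`, for `x ∈ □` and a finite
  y-range `SF ⊇ □̃³ = cthickening (3R₀) □`:
  `|Σ'_{X:P} Σ_{y∈SF} 𝐄²(X,x,y)w(y) − Σ_{y∈ℤᵈ} (Σ'_{X:P} 𝐄²(X,x,y)) w(y)| ≤ C_E e^{3Mdδ₁}K₀K₁(d,δ₀/2) K_w e^{−(δ₁/2)·3R₀} S_{δ₁/2,p,d}`;
  `xext_error` — for `x ∈ □` (κ ≥ 4κ₀(4·2ᵈ,2d)): `Σ_{y∈ℤᵈ} Π(x,y)w(y) = Σ_y (Σ'_{X⊂□̃²} 𝐄²)w + Σ_y (Σ'_{X∩(□̃²)ᶜ≠∅} 𝐄²)w`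
  and `|Σ_y (Σ'_{X⊂□̃²} 𝐄²(X,x,y)) w(y) − Σ_y Π(x,y) w(y)| ≤ C_E e^{3Mdδ₁}K₀K₁(d,δ₀/4) e^{−(δ₁/2)(2R₀ − 3Md)} K_w S_{δ₁,p,d}`.
* §3 THE CHAIN (`chain290`): under the parents' hypotheses — 𝐄(X,·) analytic on the (4.4)-ball with (1.18)
  (`han`, `h118`), both response families with the p. 282 bound (`hh₀`, `hh`), their difference on `S ⊇ supp ζ̃_□`
  with the small factor `η` (`hdiff`, the [15]-input), the (4.35) representations (`hrepr₀`, `hrepr`), `δ₀ > 0`,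
  `κ ≥ 4κ₀(4·2ᵈ,2d)` — for `x ∈ □`, a finite y-range `SF` with `□̃³ ⊆ SF ⊆ S` and a weight `|w(y)| ≤ K_w pw_p(x − y)`:
  `|Σ'_{X⊂□̃²} Σ_{y∈SF} 𝐄²₀(X,x,y) w(y) − Σ_{y∈ℤᵈ} Π(x,y) w(y)| ≤ T_repl + T_y + T_X`, the three bounds of §2 with
  `C_E = 4E₀α₂⁻²B₃²` (`B12Ext436Lattice.kernelBound_of_analytic`); the same with the X-sum outside the y-sum on
  the Π side (`chain290_X_outside`, by `B12MomentSums434.fubini434`); the three monomial weights of (4.34)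
  (`chain290_moment0`, `chain290_moment1`, `chain290_moment2`); and the finite x-sum over `supp δB ⊂ □`
  (`chain290_sum`: the bound times the number of sites).
Every series in these statements is absolutely convergent (the summability clauses of §2).

WHAT IT DOES NOT PROVE.  Nothing analytic: (4.4)/(1.18), the p. 282 response bounds and the [15] bound on
H_j(□₀) − H_j (print's factor B₀exp(−δ₀M(Lʲη)⁻¹) is the free `η ≥ 0` of `hdiff`) stay the parents' NAMED
HYPOTHESES; the field polynomials of (4.34), the first block ⟨𝐄²(X), δB, B⟩ (§5 of the paper), «the irrelevant
terms resummed over X ∈ 𝐃_j, X ⊂ □̃²», the second locus (4.38)–(4.40) p. 291, the smooth ζ̃_□ (only a finite site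
set `SF` between □̃³ and `S` enters), the torus identification of T and the Euclidean metric (ℓ¹ reading, lineage
D-b03.29) are not touched; that 𝐄⁽ʲ⁾(X,·) is defined for X ∈ 𝐃⁰_j at all is the standing structural hypothesis of
the lineage (E2, EX are free functions of the lattice domain type `LDom`).  Definition-free.  NOT summit progress:
the value is a kernel certificate that the printed bookkeeping of p. 290/291 composes as print says.

DICTIONARY / DIVERGENCE (D-b03.35): (i) «X ∈ 𝐃_j, X ⊂ □̃²» ↦ the sub-class
`{X : LDom d // ¬ MeetsZ M (cthickening (2R₀) □)ᶜ X}` of 𝐃⁰_j(ℤᵈ) («no site of a cube of X outside □̃²»; the torus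
class 𝐃_j is read inside 𝐃⁰_j, site model D-b03.14), its complement is (4.36)'s far class of `B12Cubes436`;
(ii) «supp B ⊂ supp ζ̃_□» ↦ a finite y-range `SF` with `cthickening (3R₀) □ ⊆ SF ⊆ S`, `S` = the site set on which
`hdiff` is assumed (print: S = supp ζ̃_□ ∩ Z⁴, collar unit R₀ = M(Lʲη)⁻¹); (iii) Π(x,y) ↦ `Σ' X : LDom d, E2 X x y`
(absolutely convergent, `B12Ext436Lattice.twoPoint_latt`); (iv) a (4.34) coefficient at the site x ↦ `Σ_y K(x,y) w(y)`
for a real weight of polynomial growth (D-b03.34 (iv)); (v) the three error sizes are the parents' displayed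
constants, not print's O(1)·exp(−(Lʲη)⁻¹) (the conversion is `B12Cubes436.ineq436_box_printed`, not repeated).
-/

namespace Literature.MathematicalPhysics.QuantumFieldTheory.Balaban1983to89.B12Chain290

open Literature.MathematicalPhysics.QuantumFieldTheory.Balaban1983to89
open Literature.MathematicalPhysics.QuantumFieldTheory.GawedzkiKupiainen1985.PeriodicGleason
  (pw pw_pos pw_zero_exp)
open Literature.MathematicalPhysics.QuantumFieldTheory.Balaban1983to89.B13ScaleTransfer (Pt)
open Literature.MathematicalPhysics.QuantumFieldTheory.Balaban1983to89.TreeLength (treeLen)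
open Literature.MathematicalPhysics.QuantumFieldTheory.Balaban1983to89.B12TreeDecay (kappa₀ K₀ K₀_pos)
open Literature.MathematicalPhysics.QuantumFieldTheory.Balaban1983to89.B12Decay510 (mixedDeriv delta1)
open Literature.MathematicalPhysics.QuantumFieldTheory.Balaban1983to89.B12Decay510Window (K₁ K₁_nonneg)
open Literature.MathematicalPhysics.QuantumFieldTheory.Balaban1983to89.B12Sec2to5 (l1 l1_nonneg)
open Literature.MathematicalPhysics.QuantumFieldTheory.Balaban1983to89.B12Ext436Lattice
  (LDom MeetsZ geomZ kernelBound_of_analytic kappa_nonneg_of twoPoint_latt)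
open Literature.MathematicalPhysics.QuantumFieldTheory.Balaban1983to89.B12HjFree290 (kernelBound_restr_sub)
open Literature.MathematicalPhysics.QuantumFieldTheory.Balaban1983to89.B12Cubes436
  (mem_suppZeta_of_l1_lt box_subset_suppZeta ineq436_box_l1)
open Literature.MathematicalPhysics.QuantumFieldTheory.Balaban1983to89.B12MomentSums434
  (delta1_latt_pos abs_coord_le_pw abs_coord2_le_pw weighted434_le sum_abs_latt_le twoPoint_latt_subtype
    tail434_latt fubini434)
open Set Metric

variable {d : ℕ}

/-! ## 1. Three summation facts [folklore] -/

section Folklore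

variable {ι : Type*}

/-- An absolutely convergent sum over a class splits over two complementary sub-classes:
`Σ'_X f(X) = Σ'_{X : ¬P X} f(X) + Σ'_{X : P X} f(X)` (print: 𝐃⁰_j = {X ⊂ □̃²} ∪ {X∩(□̃²)ᶜ ≠ ∅}). [folklore] -/
theorem tsum_eq_tsum_compl_add_tsum {f : ι → ℝ} (hf : Summable f) (P : ι → Prop) :
    ∑' i, f i = ∑' i : {i : ι // ¬ P i}, f i.1 + ∑' i : {i : ι // P i}, f i.1 := by
  have h := hf.tsum_subtype_add_tsum_subtype_compl {i | P i}
  rw [add_comm] at h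
  exact h.symm

/-- A finite weighted y-sum commutes with an absolutely convergent X-sum:
`Σ'_X Σ_{y∈Y} K(X,y) w(y) = Σ_{y∈Y} (Σ'_X K(X,y)) w(y)`. [folklore] -/
theorem tsum_finsetSum_mul {K : ι → Pt d → ℝ} (w : Pt d → ℝ) (Y : Finset (Pt d))
    (hs : ∀ y, Summable fun X => K X y) :
    ∑' X, ∑ y ∈ Y, K X y * w y = ∑ y ∈ Y, (∑' X, K X y) * w y := by
  rw [Summable.tsum_finsetSum (fun y _ => (hs y).mul_right (w y))]
  exact Finset.sum_congr rfl fun y _ => tsum_mul_right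

/-- On `S × S` the restricted difference kernel is the difference: for `x, y ∈ S`,
`𝟙_{S×S}(𝐄²₀ − 𝐄²)(X, x, y) = 𝐄²₀(X, x, y) − 𝐄²(X, x, y)`. [folklore] -/
theorem indicator_sub_of_mem {S : Set (Pt d)} (E2₀ E2 : LDom d → Pt d → Pt d → ℝ) (X : LDom d)
    {x y : Pt d} (hx : x ∈ S) (hy : y ∈ S) :
    (S ×ˢ S).indicator (fun q : Pt d × Pt d => E2₀ X q.1 q.2 - E2 X q.1 q.2) (x, y) =
      E2₀ X x y - E2 X x y :=
  Set.indicator_of_mem (Set.mk_mem_prod hx hy) _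

/-- A threshold `κ ≥ 4κ₀(4·2ᵈ, 2d)` implies the threshold `κ ≥ 2κ₀(4·2ᵈ, 2d)` of the two-point capstones
(`κ ≥ 0`). [folklore] -/
theorem kappa_half_of_quarter {κ : ℝ} (hκ₀ : kappa₀ (4 * 2 ^ d) (2 * d) ≤ κ / 4) :
    kappa₀ (4 * 2 ^ d) (2 * d) ≤ κ / 2 := by
  have hκ : 0 ≤ κ := kappa_nonneg_of (by norm_num) hκ₀
  linarith

end Folklore

/-! ## 2. The three changes of p. 290, each as an error bound for a (4.34) coefficient kernel `Σ_y K(x,y) w(y)` -/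

section Errors

variable {M : ℕ} {W : Type*} [NormedAddCommGroup W] [NormedSpace ℂ W]

/-- **«If we replace H_j(□₀) by H_j with free boundary conditions … this change increases the sum of the
irrelevant terms by the expression of the form (4.34), but with very small coefficients»** — as the ERROR of the
replacement in a (4.34) coefficient, kernel summed over any sub-class `{X : P X}` of 𝐃⁰_j(ℤᵈ) (print's X ⊂ □̃²),
y over a finite range `Y ⊆ S` and `x ∈ S` (print: supp δB ⊂ □ ⊂ supp ζ̃_□ = S ⊃ supp B): both expressions are
absolutely convergent in X and
`|Σ'_{X:P} Σ_{y∈Y} 𝐄²₀(X,x,y) w(y) − Σ'_{X:P} Σ_{y∈Y} 𝐄²(X,x,y) w(y)| ≤ (8E₀α₂⁻²B₃η)·e^{3Mdδ₁}K₀(4·2ᵈ,2d)K₁(d,δ₀/2)·K_w·S_{δ₁,p,d}`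
(`δ₀ > 0`, `κ ≥ 2κ₀(4·2ᵈ,2d)`; the smallness is the factor `η` of the NAMED HYPOTHESIS `hdiff`, print's
B₀exp(−δ₀M(Lʲη)⁻¹) from [15]; `B12HjFree290.kernelBound_restr_sub`, `B12MomentSums434.weighted434_le`).
[cite: Balaban1987RG1, (4.34)-(4.35) p.290] -/
theorem replacement_error (hd : 0 < d) (hM : 0 < M) (EX : LDom d → W → ℂ)
    (h₀ h : LDom d → Pt d → W) (E2₀ E2 : LDom d → Pt d → Pt d → ℝ) {S : Set (Pt d)}
    {α₂ E₀ B₃ η κ δ₀ : ℝ} (hα₂ : 0 < α₂) (hE₀ : 0 ≤ E₀) (hB₃ : 0 ≤ B₃) (hη : 0 ≤ η) (hδ₀ : 0 < δ₀)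
    (hκ₀ : kappa₀ (4 * 2 ^ d) (2 * d) ≤ κ / 2)
    (han : ∀ X, AnalyticOnNhd ℂ (EX X) (ball 0 α₂))
    (h118 : ∀ X, ∀ v ∈ ball (0 : W) α₂, ‖EX X v‖ ≤ E₀ * Real.exp (-κ * treeLen X.1))
    (hrepr₀ : ∀ X x y, E2₀ X x y = (mixedDeriv (EX X) (h₀ X x) (h₀ X y)).re)
    (hrepr : ∀ X x y, E2 X x y = (mixedDeriv (EX X) (h X x) (h X y)).re)
    (hh₀ : ∀ X x, ‖h₀ X x‖ ≤ B₃ * Real.exp (-δ₀ * (geomZ d M).distD x X))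
    (hh : ∀ X x, ‖h X x‖ ≤ B₃ * Real.exp (-δ₀ * (geomZ d M).distD x X))
    (hdiff : ∀ X, ∀ x ∈ S, ‖h₀ X x - h X x‖ ≤ η * Real.exp (-δ₀ * (geomZ d M).distD x X))
    (P : LDom d → Prop) {x : Pt d} (hxS : x ∈ S) (Y : Finset (Pt d)) (hY : (↑Y : Set (Pt d)) ⊆ S)
    {w : Pt d → ℝ} {KW : ℝ} {p : ℕ} (hKW : 0 ≤ KW) (hw : ∀ y, |w y| ≤ KW * pw p (x - y)) :
    (Summable fun X : {X : LDom d // P X} => ∑ y ∈ Y, E2₀ X.1 x y * w y) ∧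
    (Summable fun X : {X : LDom d // P X} => ∑ y ∈ Y, E2 X.1 x y * w y) ∧
    |∑' X : {X : LDom d // P X}, ∑ y ∈ Y, E2₀ X.1 x y * w y -
        ∑' X : {X : LDom d // P X}, ∑ y ∈ Y, E2 X.1 x y * w y| ≤
      8 * E₀ / α₂ ^ 2 * B₃ * η * Real.exp (delta1 δ₀ κ ((M : ℝ) * d) * ((M : ℝ) * d) * 3) *
        K₀ (4 * 2 ^ d) (2 * d) * K₁ d (δ₀ / 2) * KW *
        B12WholeLattice290.S (delta1 δ₀ κ ((M : ℝ) * d)) p d := by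
  have hC : 0 ≤ 4 * E₀ / α₂ ^ 2 * B₃ ^ 2 := by positivity
  have hCD : 0 ≤ 8 * E₀ / α₂ ^ 2 * B₃ * η := by positivity
  have hE₀K : (geomZ d M).KernelBound E2₀ (4 * E₀ / α₂ ^ 2 * B₃ ^ 2) κ δ₀ :=
    kernelBound_of_analytic (geomZ d M) EX h₀ E2₀ hα₂ hE₀ hB₃ han h118 hrepr₀ hh₀
  have hEK : (geomZ d M).KernelBound E2 (4 * E₀ / α₂ ^ 2 * B₃ ^ 2) κ δ₀ :=
    kernelBound_of_analytic (geomZ d M) EX h E2 hα₂ hE₀ hB₃ han h118 hrepr hh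
  have hDK := kernelBound_restr_sub (geomZ d M) EX h₀ h E2₀ E2 hα₂ hE₀ hB₃ hη han h118 hrepr₀ hrepr hh₀ hh
    hdiff
  have ha := delta1_latt_pos hd hM two_pos hδ₀ hκ₀
  -- summability in X of the single terms and of the restricted difference, and the two-point bound of the latter
  have hs₀ : ∀ y, Summable fun X : {X : LDom d // P X} => E2₀ X.1 x y := fun y =>
    (twoPoint_latt_subtype hd hM hC hδ₀ hκ₀ hE₀K P x y).1
  have hs : ∀ y, Summable fun X : {X : LDom d // P X} => E2 X.1 x y := fun y =>
    (twoPoint_latt_subtype hd hM hC hδ₀ hκ₀ hEK P x y).1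
  have hsD : ∀ y, Summable fun X : {X : LDom d // P X} =>
      (S ×ˢ S).indicator (fun q : Pt d × Pt d => E2₀ X.1 q.1 q.2 - E2 X.1 q.1 q.2) (x, y) := fun y =>
    (twoPoint_latt_subtype hd hM hCD hδ₀ hκ₀ hDK P x y).1
  have hbD : ∀ y, |∑' X : {X : LDom d // P X},
      (S ×ˢ S).indicator (fun q : Pt d × Pt d => E2₀ X.1 q.1 q.2 - E2 X.1 q.1 q.2) (x, y)| ≤
      8 * E₀ / α₂ ^ 2 * B₃ * η * Real.exp (delta1 δ₀ κ ((M : ℝ) * d) * ((M : ℝ) * d) * 3) *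
        K₀ (4 * 2 ^ d) (2 * d) * K₁ d (δ₀ / 2) *
        Real.exp (-delta1 δ₀ κ ((M : ℝ) * d) * l1 (x - y)) := fun y =>
    (twoPoint_latt_subtype hd hM hCD hδ₀ hκ₀ hDK P x y).2
  have hS₀ : Summable fun X : {X : LDom d // P X} => ∑ y ∈ Y, E2₀ X.1 x y * w y :=
    summable_sum fun y _ => (hs₀ y).mul_right (w y)
  have hS : Summable fun X : {X : LDom d // P X} => ∑ y ∈ Y, E2 X.1 x y * w y :=
    summable_sum fun y _ => (hs y).mul_right (w y)
  refine ⟨hS₀, hS, ?_⟩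
  -- the difference of the two expressions is the (4.34)-type finite y-sum of the restricted difference kernel
  have e2 : ∀ X : {X : LDom d // P X},
      ∑ y ∈ Y, E2₀ X.1 x y * w y - ∑ y ∈ Y, E2 X.1 x y * w y =
        ∑ y ∈ Y, (S ×ˢ S).indicator (fun q : Pt d × Pt d => E2₀ X.1 q.1 q.2 - E2 X.1 q.1 q.2) (x, y) * w y :=
    fun X => by
      rw [← Finset.sum_sub_distrib]
      refine Finset.sum_congr rfl fun y hy => ?_
      rw [← sub_mul, indicator_sub_of_mem E2₀ E2 X.1 hxS (hY (Finset.mem_coe.2 hy))]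
  have e1 : ∑' X : {X : LDom d // P X}, ∑ y ∈ Y, E2₀ X.1 x y * w y -
      ∑' X : {X : LDom d // P X}, ∑ y ∈ Y, E2 X.1 x y * w y =
      ∑ y ∈ Y, (∑' X : {X : LDom d // P X},
        (S ×ˢ S).indicator (fun q : Pt d × Pt d => E2₀ X.1 q.1 q.2 - E2 X.1 q.1 q.2) (x, y)) * w y := by
    rw [← hS₀.tsum_sub hS, tsum_congr e2]
    exact tsum_finsetSum_mul
      (K := fun (X : {X : LDom d // P X}) y =>
        (S ×ˢ S).indicator (fun q : Pt d × Pt d => E2₀ X.1 q.1 q.2 - E2 X.1 q.1 q.2) (x, y)) w Y hsD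
  rw [e1]
  exact (weighted434_le
    (K := fun x y => ∑' X : {X : LDom d // P X},
      (S ×ˢ S).indicator (fun q : Pt d × Pt d => E2₀ X.1 q.1 q.2 - E2 X.1 q.1 q.2) (x, y)) ha hbD hKW hw).2.2 Y

/-- **«Next, we extend summations over y to the whole lattice Z⁴. The difference between the sum over supp ζ̃_□
and the sum over Z⁴ is a sum over a subset of (□̃³)ᶜ∩Z⁴. This gives again the exponentially small
coefficients»** — for the kernel AS IT STANDS at this step (summed over a sub-class `{X : P X}`, print's X ⊂ □̃²;
not translation invariant), under the kernel bound `KernelBound E2 C_E κ δ₀` (`δ₀ > 0`, `κ ≥ 2κ₀(4·2ᵈ,2d)`), for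
`x ∈ □` and a finite y-range `SF ⊇ □̃³ = cthickening (3R₀) □` (print: SF = supp ζ̃_□ ∩ Z⁴, R₀ = M(Lʲη)⁻¹): the
X-sum commutes with the finite y-sum, the whole-lattice coefficient converges absolutely, and
`|Σ'_{X:P} Σ_{y∈SF} 𝐄²(X,x,y) w(y) − Σ_{y∈ℤᵈ} (Σ'_{X:P} 𝐄²(X,x,y)) w(y)| ≤ C_E e^{3Mdδ₁}K₀(4·2ᵈ,2d)K₁(d,δ₀/2)·K_w·e^{−(δ₁/2)·3R₀}·S_{δ₁/2,p,d}`
(`B12MomentSums434.tail434_latt`, `B12Cubes436.mem_suppZeta_of_l1_lt`). [cite: Balaban1987RG1, p.290] -/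
theorem yext_error (hd : 0 < d) (hM : 0 < M) {E2 : LDom d → Pt d → Pt d → ℝ} {CE κ δ₀ R₀ : ℝ}
    {B : Set (Pt d)} (hCE : 0 ≤ CE) (hδ₀ : 0 < δ₀) (hκ₀ : kappa₀ (4 * 2 ^ d) (2 * d) ≤ κ / 2)
    (hE : (geomZ d M).KernelBound E2 CE κ δ₀) (P : LDom d → Prop) (SF : Finset (Pt d))
    (h3 : cthickening (3 * R₀) B ⊆ ↑SF) {x : Pt d} (hx : x ∈ B)
    {w : Pt d → ℝ} {KW : ℝ} {p : ℕ} (hKW : 0 ≤ KW) (hw : ∀ y, |w y| ≤ KW * pw p (x - y)) :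
    (Summable fun X : {X : LDom d // P X} => ∑ y ∈ SF, E2 X.1 x y * w y) ∧
    (Summable fun y => (∑' X : {X : LDom d // P X}, E2 X.1 x y) * w y) ∧
    ∑' X : {X : LDom d // P X}, ∑ y ∈ SF, E2 X.1 x y * w y =
      ∑ y ∈ SF, (∑' X : {X : LDom d // P X}, E2 X.1 x y) * w y ∧
    |∑' X : {X : LDom d // P X}, ∑ y ∈ SF, E2 X.1 x y * w y -
        ∑' y, (∑' X : {X : LDom d // P X}, E2 X.1 x y) * w y| ≤
      CE * Real.exp (delta1 δ₀ κ ((M : ℝ) * d) * ((M : ℝ) * d) * 3) * K₀ (4 * 2 ^ d) (2 * d) *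
        K₁ d (δ₀ / 2) * KW * Real.exp (-(delta1 δ₀ κ ((M : ℝ) * d) / 2) * (3 * R₀)) *
        B12WholeLattice290.S (delta1 δ₀ κ ((M : ℝ) * d) / 2) p d := by
  have ha := delta1_latt_pos hd hM two_pos hδ₀ hκ₀
  have hs : ∀ y, Summable fun X : {X : LDom d // P X} => E2 X.1 x y := fun y =>
    (twoPoint_latt_subtype hd hM hCE hδ₀ hκ₀ hE P x y).1
  have hb : ∀ y, |∑' X : {X : LDom d // P X}, E2 X.1 x y| ≤
      CE * Real.exp (delta1 δ₀ κ ((M : ℝ) * d) * ((M : ℝ) * d) * 3) * K₀ (4 * 2 ^ d) (2 * d) *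
        K₁ d (δ₀ / 2) * Real.exp (-delta1 δ₀ κ ((M : ℝ) * d) * l1 (x - y)) := fun y =>
    (twoPoint_latt_subtype hd hM hCE hδ₀ hκ₀ hE P x y).2
  have hS : Summable fun X : {X : LDom d // P X} => ∑ y ∈ SF, E2 X.1 x y * w y :=
    summable_sum fun y _ => (hs y).mul_right (w y)
  have hT : Summable fun y => (∑' X : {X : LDom d // P X}, E2 X.1 x y) * w y :=
    (weighted434_le (K := fun x y => ∑' X : {X : LDom d // P X}, E2 X.1 x y) ha hb hKW hw).1
  have e : ∑' X : {X : LDom d // P X}, ∑ y ∈ SF, E2 X.1 x y * w y =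
      ∑ y ∈ SF, (∑' X : {X : LDom d // P X}, E2 X.1 x y) * w y :=
    tsum_finsetSum_mul (K := fun (X : {X : LDom d // P X}) y => E2 X.1 x y) w SF hs
  refine ⟨hS, hT, e, ?_⟩
  rw [e, abs_sub_comm]
  exact tail434_latt hd hM hCE hδ₀ hκ₀ hE P x hKW hw (3 * R₀) SF fun y hy =>
    Finset.mem_coe.1 (mem_suppZeta_of_l1_lt h3 hx hy)

/-- **«Finally, the crucial step is an extension of the sum over localization domains X … we sum the function
𝐄⁽²⁾(X) over X ∈ 𝐃⁰_j … The difference between the two sums gives a function satisfying … (4.36) … hence,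
substituting it into (4.34), we get an irrelevant expression again»** — as the ERROR of the X-extension in a
whole-lattice (4.34) coefficient: under the kernel bound (`δ₀ > 0`, `κ ≥ 4κ₀(4·2ᵈ,2d)`), for `x ∈ □` and
□̃² = `cthickening (2R₀) □`, with Π(x,y) = Σ'_{X∈𝐃⁰_j(ℤᵈ)} 𝐄²(X,x,y): the three whole-lattice coefficients (Π,
the class X ⊂ □̃², the far class) converge absolutely, `Σ_y Π(x,y)w(y) = Σ_y (Σ'_{X⊂□̃²} 𝐄²)w + Σ_y (Σ'_{X∩(□̃²)ᶜ≠∅} 𝐄²)w`,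
and `|Σ_y (Σ'_{X⊂□̃²} 𝐄²(X,x,y)) w(y) − Σ_y Π(x,y) w(y)| ≤ C_E e^{3Mdδ₁}K₀(4·2ᵈ,2d)K₁(d,δ₀/4) e^{−(δ₁/2)(2R₀ − 3Md)}·K_w·S_{δ₁,p,d}`
(`B12Cubes436.ineq436_box_l1` substituted into the weighted sum, `B12MomentSums434.weighted434_le`).
[cite: Balaban1987RG1, (4.36)-(4.37) pp.290-291] -/
theorem xext_error (hd : 0 < d) (hM : 0 < M) {E2 : LDom d → Pt d → Pt d → ℝ} {CE κ δ₀ R₀ : ℝ}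
    {B : Set (Pt d)} (hCE : 0 ≤ CE) (hδ₀ : 0 < δ₀) (hκ₀ : kappa₀ (4 * 2 ^ d) (2 * d) ≤ κ / 4)
    (hE : (geomZ d M).KernelBound E2 CE κ δ₀) {x : Pt d} (hx : x ∈ B)
    {w : Pt d → ℝ} {KW : ℝ} {p : ℕ} (hKW : 0 ≤ KW) (hw : ∀ y, |w y| ≤ KW * pw p (x - y)) :
    (Summable fun y => (∑' X : LDom d, E2 X x y) * w y) ∧
    (Summable fun y => (∑' X : {X : LDom d // ¬ MeetsZ M (cthickening (2 * R₀) B)ᶜ X}, E2 X.1 x y) * w y) ∧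
    (Summable fun y => (∑' X : {X : LDom d // MeetsZ M (cthickening (2 * R₀) B)ᶜ X}, E2 X.1 x y) * w y) ∧
    ∑' y, (∑' X : LDom d, E2 X x y) * w y =
      ∑' y, (∑' X : {X : LDom d // ¬ MeetsZ M (cthickening (2 * R₀) B)ᶜ X}, E2 X.1 x y) * w y +
        ∑' y, (∑' X : {X : LDom d // MeetsZ M (cthickening (2 * R₀) B)ᶜ X}, E2 X.1 x y) * w y ∧
    |∑' y, (∑' X : {X : LDom d // ¬ MeetsZ M (cthickening (2 * R₀) B)ᶜ X}, E2 X.1 x y) * w y -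
        ∑' y, (∑' X : LDom d, E2 X x y) * w y| ≤
      CE * Real.exp (delta1 δ₀ κ ((M : ℝ) * d) * ((M : ℝ) * d) * 3) * K₀ (4 * 2 ^ d) (2 * d) *
        K₁ d (δ₀ / 4) * Real.exp (-(delta1 δ₀ κ ((M : ℝ) * d) / 2) * (2 * R₀ - (M : ℝ) * d * 3)) * KW *
        B12WholeLattice290.S (delta1 δ₀ κ ((M : ℝ) * d)) p d := by
  have hκ2 : kappa₀ (4 * 2 ^ d) (2 * d) ≤ κ / 2 := kappa_half_of_quarter hκ₀
  have ha := delta1_latt_pos hd hM two_pos hδ₀ hκ2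
  -- two-point bounds: the whole class, the class X ⊂ □̃², the far class (4.36)
  have hbA : ∀ y, |∑' X : LDom d, E2 X x y| ≤
      CE * Real.exp (delta1 δ₀ κ ((M : ℝ) * d) * ((M : ℝ) * d) * 3) * K₀ (4 * 2 ^ d) (2 * d) *
        K₁ d (δ₀ / 2) * Real.exp (-(delta1 δ₀ κ ((M : ℝ) * d)) * l1 (x - y)) := fun y =>
    (twoPoint_latt hd hM hCE hδ₀ hκ2 hE x y).2
  have hbN : ∀ y, |∑' X : {X : LDom d // ¬ MeetsZ M (cthickening (2 * R₀) B)ᶜ X}, E2 X.1 x y| ≤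
      CE * Real.exp (delta1 δ₀ κ ((M : ℝ) * d) * ((M : ℝ) * d) * 3) * K₀ (4 * 2 ^ d) (2 * d) *
        K₁ d (δ₀ / 2) * Real.exp (-delta1 δ₀ κ ((M : ℝ) * d) * l1 (x - y)) := fun y =>
    (twoPoint_latt_subtype hd hM hCE hδ₀ hκ2 hE (fun X => ¬ MeetsZ M (cthickening (2 * R₀) B)ᶜ X) x y).2
  have hbF : ∀ y, |∑' X : {X : LDom d // MeetsZ M (cthickening (2 * R₀) B)ᶜ X}, E2 X.1 x y| ≤
      CE * Real.exp (delta1 δ₀ κ ((M : ℝ) * d) * ((M : ℝ) * d) * 3) * K₀ (4 * 2 ^ d) (2 * d) *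
        K₁ d (δ₀ / 4) * Real.exp (-(delta1 δ₀ κ ((M : ℝ) * d) / 2) * (2 * R₀ - (M : ℝ) * d * 3)) *
        Real.exp (-(delta1 δ₀ κ ((M : ℝ) * d)) * l1 (x - y)) := fun y =>
    (ineq436_box_l1 hd hM hCE hδ₀ hκ₀ hE hx y).2
  have hTA : Summable fun y => (∑' X : LDom d, E2 X x y) * w y :=
    (weighted434_le (K := fun x y => ∑' X : LDom d, E2 X x y) ha hbA hKW hw).1
  have hTN : Summable fun y =>
      (∑' X : {X : LDom d // ¬ MeetsZ M (cthickening (2 * R₀) B)ᶜ X}, E2 X.1 x y) * w y :=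
    (weighted434_le (K := fun x y => ∑' X : {X : LDom d // ¬ MeetsZ M (cthickening (2 * R₀) B)ᶜ X},
      E2 X.1 x y) ha hbN hKW hw).1
  have hWF := weighted434_le
    (K := fun x y => ∑' X : {X : LDom d // MeetsZ M (cthickening (2 * R₀) B)ᶜ X}, E2 X.1 x y) ha hbF hKW hw
  -- «we sum the function 𝐄⁽²⁾(X) over X ∈ 𝐃⁰_j»: pointwise in y, Π = (sum over X ⊂ □̃²) + (far sum)
  have hsplit : ∀ y, ∑' X : LDom d, E2 X x y =
      ∑' X : {X : LDom d // ¬ MeetsZ M (cthickening (2 * R₀) B)ᶜ X}, E2 X.1 x y +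
        ∑' X : {X : LDom d // MeetsZ M (cthickening (2 * R₀) B)ᶜ X}, E2 X.1 x y := fun y =>
    tsum_eq_tsum_compl_add_tsum (twoPoint_latt hd hM hCE hδ₀ hκ2 hE x y).1
      (MeetsZ M (cthickening (2 * R₀) B)ᶜ)
  have e : ∑' y, (∑' X : LDom d, E2 X x y) * w y =
      ∑' y, (∑' X : {X : LDom d // ¬ MeetsZ M (cthickening (2 * R₀) B)ᶜ X}, E2 X.1 x y) * w y +
        ∑' y, (∑' X : {X : LDom d // MeetsZ M (cthickening (2 * R₀) B)ᶜ X}, E2 X.1 x y) * w y := by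
    rw [← hTN.tsum_add hWF.1]
    exact tsum_congr fun y => by rw [hsplit y, add_mul]
  refine ⟨hTA, hTN, hWF.1, e, ?_⟩
  have e' : ∑' y, (∑' X : {X : LDom d // ¬ MeetsZ M (cthickening (2 * R₀) B)ᶜ X}, E2 X.1 x y) * w y -
      ∑' y, (∑' X : LDom d, E2 X x y) * w y =
      -(∑' y, (∑' X : {X : LDom d // MeetsZ M (cthickening (2 * R₀) B)ᶜ X}, E2 X.1 x y) * w y) := by
    rw [e]; ring
  rw [e', abs_neg]
  exact hWF.2.1

end Errors

/-! ## 3. «Thus, after all the changes and resummations, we obtain an expression which is equal to this in (4.34),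
with the function 𝐄⁽²⁾_{μ,ν}(X, x, y) replaced by Π_{μ,ν}(x, y) = Σ_{X∈𝐃⁰_j} 𝐄⁽²⁾_{μ,ν}(X, x, y)» — the chain -/

section Chain

variable {M : ℕ} {W : Type*} [NormedAddCommGroup W] [NormedSpace ℂ W]

/-- **THE p. 290/291 CHAIN FOR A (4.34) COEFFICIENT KERNEL, AS ONE INEQUALITY.**  Hypotheses (all the parents'
NAMED HYPOTHESES, nothing derived here): 𝐄(X,·) analytic on the (4.4)-ball ‖𝐀‖ < α₂ with (1.18) there
(`han`, `h118`); the (4.35) kernels of H_j(□₀) and of H_j, `𝐄²₀ = Re ∂²𝐄_X(h⁰_X(x), h⁰_X(y))`,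
`𝐄² = Re ∂²𝐄_X(h_X(x), h_X(y))` (`hrepr₀`, `hrepr`); the p. 282 response bounds with `B₃` (`hh₀`, `hh`); the [15]
bound on the difference of the responses on the site set `S ⊇ supp ζ̃_□` with the small factor `η`
(`hdiff`); `δ₀ > 0`, `κ ≥ 4κ₀(4·2ᵈ,2d)`, cubes of side `M ≥ 1`, `d ≥ 1`.  Ranges: `x ∈ □` (any set of sites `B`),
y over a finite set `SF` with `□̃³ = cthickening (3R₀) □ ⊆ SF ⊆ S` (print: supp B ⊂ supp ζ̃_□, ζ̃_□ = 1 on □̃³),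
a real weight `|w(y)| ≤ K_w pw_p(x − y)` (the monomials of (4.34)).  CONCLUSION: the expression one starts from —
kernel of H_j(□₀), X ⊂ □̃² (no cube-site of X outside □̃²), y ∈ SF — and the one print ends with — the vacuum
polarization kernel Π(x,y) = Σ'_{X∈𝐃⁰_j(ℤᵈ)} 𝐄²(X,x,y) of (4.37), y ∈ ℤᵈ — satisfy
`|Σ'_{X⊂□̃²} Σ_{y∈SF} 𝐄²₀(X,x,y) w(y) − Σ_{y∈ℤᵈ} Π(x,y) w(y)|`
`  ≤ (8E₀α₂⁻²B₃η)·e^{3Mdδ₁}K₀K₁(d,δ₀/2)·K_w·S_{δ₁,p,d}`                                   («very small coefficients»)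
`  + (4E₀α₂⁻²B₃²)·e^{3Mdδ₁}K₀K₁(d,δ₀/2)·K_w·e^{−(δ₁/2)·3R₀}·S_{δ₁/2,p,d}`                  («a subset of (□̃³)ᶜ∩Z⁴»)
`  + (4E₀α₂⁻²B₃²)·e^{3Mdδ₁}K₀K₁(d,δ₀/4)·e^{−(δ₁/2)(2R₀ − 3Md)}·K_w·S_{δ₁,p,d}`              ((4.36))
with `K₀ = K₀(4·2ᵈ,2d)`, `δ₁ = ½ min{δ₀, κ(Md)⁻¹}`, every series absolutely convergent (§2).
[cite: Balaban1987RG1, p.290 and (4.37) p.291] -/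
theorem chain290 (hd : 0 < d) (hM : 0 < M) (EX : LDom d → W → ℂ)
    (h₀ h : LDom d → Pt d → W) (E2₀ E2 : LDom d → Pt d → Pt d → ℝ) {S : Set (Pt d)}
    {α₂ E₀ B₃ η κ δ₀ R₀ : ℝ} {B : Set (Pt d)} (SF : Finset (Pt d))
    (hα₂ : 0 < α₂) (hE₀ : 0 ≤ E₀) (hB₃ : 0 ≤ B₃) (hη : 0 ≤ η) (hδ₀ : 0 < δ₀)
    (hκ₀ : kappa₀ (4 * 2 ^ d) (2 * d) ≤ κ / 4)
    (han : ∀ X, AnalyticOnNhd ℂ (EX X) (ball 0 α₂))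
    (h118 : ∀ X, ∀ v ∈ ball (0 : W) α₂, ‖EX X v‖ ≤ E₀ * Real.exp (-κ * treeLen X.1))
    (hrepr₀ : ∀ X x y, E2₀ X x y = (mixedDeriv (EX X) (h₀ X x) (h₀ X y)).re)
    (hrepr : ∀ X x y, E2 X x y = (mixedDeriv (EX X) (h X x) (h X y)).re)
    (hh₀ : ∀ X x, ‖h₀ X x‖ ≤ B₃ * Real.exp (-δ₀ * (geomZ d M).distD x X))
    (hh : ∀ X x, ‖h X x‖ ≤ B₃ * Real.exp (-δ₀ * (geomZ d M).distD x X))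
    (hdiff : ∀ X, ∀ x ∈ S, ‖h₀ X x - h X x‖ ≤ η * Real.exp (-δ₀ * (geomZ d M).distD x X))
    (h3 : cthickening (3 * R₀) B ⊆ ↑SF) (hSF : (↑SF : Set (Pt d)) ⊆ S) {x : Pt d} (hx : x ∈ B)
    {w : Pt d → ℝ} {KW : ℝ} {p : ℕ} (hKW : 0 ≤ KW) (hw : ∀ y, |w y| ≤ KW * pw p (x - y)) :
    |∑' X : {X : LDom d // ¬ MeetsZ M (cthickening (2 * R₀) B)ᶜ X}, ∑ y ∈ SF, E2₀ X.1 x y * w y -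
        ∑' y, (∑' X : LDom d, E2 X x y) * w y| ≤
      8 * E₀ / α₂ ^ 2 * B₃ * η * Real.exp (delta1 δ₀ κ ((M : ℝ) * d) * ((M : ℝ) * d) * 3) *
          K₀ (4 * 2 ^ d) (2 * d) * K₁ d (δ₀ / 2) * KW * B12WholeLattice290.S (delta1 δ₀ κ ((M : ℝ) * d)) p d +
        4 * E₀ / α₂ ^ 2 * B₃ ^ 2 * Real.exp (delta1 δ₀ κ ((M : ℝ) * d) * ((M : ℝ) * d) * 3) *
          K₀ (4 * 2 ^ d) (2 * d) * K₁ d (δ₀ / 2) * KW * Real.exp (-(delta1 δ₀ κ ((M : ℝ) * d) / 2) * (3 * R₀)) *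
          B12WholeLattice290.S (delta1 δ₀ κ ((M : ℝ) * d) / 2) p d +
        4 * E₀ / α₂ ^ 2 * B₃ ^ 2 * Real.exp (delta1 δ₀ κ ((M : ℝ) * d) * ((M : ℝ) * d) * 3) *
          K₀ (4 * 2 ^ d) (2 * d) * K₁ d (δ₀ / 4) *
          Real.exp (-(delta1 δ₀ κ ((M : ℝ) * d) / 2) * (2 * R₀ - (M : ℝ) * d * 3)) * KW *
          B12WholeLattice290.S (delta1 δ₀ κ ((M : ℝ) * d)) p d := by
  have hκ2 : kappa₀ (4 * 2 ^ d) (2 * d) ≤ κ / 2 := kappa_half_of_quarter hκ₀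
  have hC : 0 ≤ 4 * E₀ / α₂ ^ 2 * B₃ ^ 2 := by positivity
  have hEK : (geomZ d M).KernelBound E2 (4 * E₀ / α₂ ^ 2 * B₃ ^ 2) κ δ₀ :=
    kernelBound_of_analytic (geomZ d M) EX h E2 hα₂ hE₀ hB₃ han h118 hrepr hh
  have hxS : x ∈ S := hSF (box_subset_suppZeta h3 hx)
  -- the three changes
  have h1 := (replacement_error hd hM EX h₀ h E2₀ E2 hα₂ hE₀ hB₃ hη hδ₀ hκ2 han h118 hrepr₀ hrepr hh₀ hh hdiff
    (fun X => ¬ MeetsZ M (cthickening (2 * R₀) B)ᶜ X) hxS SF hSF hKW hw).2.2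
  have h2 := (yext_error hd hM hC hδ₀ hκ2 hEK (fun X => ¬ MeetsZ M (cthickening (2 * R₀) B)ᶜ X) SF h3 hx
    hKW hw).2.2.2
  have h3' := (xext_error (R₀ := R₀) hd hM hC hδ₀ hκ₀ hEK hx hKW hw).2.2.2.2
  have e : ∑' X : {X : LDom d // ¬ MeetsZ M (cthickening (2 * R₀) B)ᶜ X}, ∑ y ∈ SF, E2₀ X.1 x y * w y -
      ∑' y, (∑' X : LDom d, E2 X x y) * w y =
      (∑' X : {X : LDom d // ¬ MeetsZ M (cthickening (2 * R₀) B)ᶜ X}, ∑ y ∈ SF, E2₀ X.1 x y * w y -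
        ∑' X : {X : LDom d // ¬ MeetsZ M (cthickening (2 * R₀) B)ᶜ X}, ∑ y ∈ SF, E2 X.1 x y * w y) +
      (∑' X : {X : LDom d // ¬ MeetsZ M (cthickening (2 * R₀) B)ᶜ X}, ∑ y ∈ SF, E2 X.1 x y * w y -
        ∑' y, (∑' X : {X : LDom d // ¬ MeetsZ M (cthickening (2 * R₀) B)ᶜ X}, E2 X.1 x y) * w y) +
      (∑' y, (∑' X : {X : LDom d // ¬ MeetsZ M (cthickening (2 * R₀) B)ᶜ X}, E2 X.1 x y) * w y -
        ∑' y, (∑' X : LDom d, E2 X x y) * w y) := by ring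
  rw [e]
  exact (abs_add_three _ _ _).trans (add_le_add_three h1 h2 h3')

/-- **The chain with the X-sum OUTSIDE the whole-lattice y-sum on the Π side** (print sums «the function 𝐄⁽²⁾(X)
over X ∈ 𝐃⁰_j» term by term in (4.34): `Σ'_{X∈𝐃⁰_j} Σ_{y∈ℤᵈ} 𝐄²(X,x,y) w(y) = Σ_{y∈ℤᵈ} Π(x,y) w(y)` by
`B12MomentSums434.fubini434`, absolutely convergent as a double series), same three-term bound.
[cite: Balaban1987RG1, p.290 and (4.37) p.291] -/
theorem chain290_X_outside (hd : 0 < d) (hM : 0 < M) (EX : LDom d → W → ℂ)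
    (h₀ h : LDom d → Pt d → W) (E2₀ E2 : LDom d → Pt d → Pt d → ℝ) {S : Set (Pt d)}
    {α₂ E₀ B₃ η κ δ₀ R₀ : ℝ} {B : Set (Pt d)} (SF : Finset (Pt d))
    (hα₂ : 0 < α₂) (hE₀ : 0 ≤ E₀) (hB₃ : 0 ≤ B₃) (hη : 0 ≤ η) (hδ₀ : 0 < δ₀)
    (hκ₀ : kappa₀ (4 * 2 ^ d) (2 * d) ≤ κ / 4)
    (han : ∀ X, AnalyticOnNhd ℂ (EX X) (ball 0 α₂))
    (h118 : ∀ X, ∀ v ∈ ball (0 : W) α₂, ‖EX X v‖ ≤ E₀ * Real.exp (-κ * treeLen X.1))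
    (hrepr₀ : ∀ X x y, E2₀ X x y = (mixedDeriv (EX X) (h₀ X x) (h₀ X y)).re)
    (hrepr : ∀ X x y, E2 X x y = (mixedDeriv (EX X) (h X x) (h X y)).re)
    (hh₀ : ∀ X x, ‖h₀ X x‖ ≤ B₃ * Real.exp (-δ₀ * (geomZ d M).distD x X))
    (hh : ∀ X x, ‖h X x‖ ≤ B₃ * Real.exp (-δ₀ * (geomZ d M).distD x X))
    (hdiff : ∀ X, ∀ x ∈ S, ‖h₀ X x - h X x‖ ≤ η * Real.exp (-δ₀ * (geomZ d M).distD x X))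
    (h3 : cthickening (3 * R₀) B ⊆ ↑SF) (hSF : (↑SF : Set (Pt d)) ⊆ S) {x : Pt d} (hx : x ∈ B)
    {w : Pt d → ℝ} {KW : ℝ} {p : ℕ} (hKW : 0 ≤ KW) (hw : ∀ y, |w y| ≤ KW * pw p (x - y)) :
    ∑' X : LDom d, ∑' y, E2 X x y * w y = ∑' y, (∑' X : LDom d, E2 X x y) * w y ∧
    |∑' X : {X : LDom d // ¬ MeetsZ M (cthickening (2 * R₀) B)ᶜ X}, ∑ y ∈ SF, E2₀ X.1 x y * w y -
        ∑' X : LDom d, ∑' y, E2 X x y * w y| ≤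
      8 * E₀ / α₂ ^ 2 * B₃ * η * Real.exp (delta1 δ₀ κ ((M : ℝ) * d) * ((M : ℝ) * d) * 3) *
          K₀ (4 * 2 ^ d) (2 * d) * K₁ d (δ₀ / 2) * KW * B12WholeLattice290.S (delta1 δ₀ κ ((M : ℝ) * d)) p d +
        4 * E₀ / α₂ ^ 2 * B₃ ^ 2 * Real.exp (delta1 δ₀ κ ((M : ℝ) * d) * ((M : ℝ) * d) * 3) *
          K₀ (4 * 2 ^ d) (2 * d) * K₁ d (δ₀ / 2) * KW * Real.exp (-(delta1 δ₀ κ ((M : ℝ) * d) / 2) * (3 * R₀)) *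
          B12WholeLattice290.S (delta1 δ₀ κ ((M : ℝ) * d) / 2) p d +
        4 * E₀ / α₂ ^ 2 * B₃ ^ 2 * Real.exp (delta1 δ₀ κ ((M : ℝ) * d) * ((M : ℝ) * d) * 3) *
          K₀ (4 * 2 ^ d) (2 * d) * K₁ d (δ₀ / 4) *
          Real.exp (-(delta1 δ₀ κ ((M : ℝ) * d) / 2) * (2 * R₀ - (M : ℝ) * d * 3)) * KW *
          B12WholeLattice290.S (delta1 δ₀ κ ((M : ℝ) * d)) p d := by
  have hκ2 : kappa₀ (4 * 2 ^ d) (2 * d) ≤ κ / 2 := kappa_half_of_quarter hκ₀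
  have hC : 0 ≤ 4 * E₀ / α₂ ^ 2 * B₃ ^ 2 := by positivity
  have hEK : (geomZ d M).KernelBound E2 (4 * E₀ / α₂ ^ 2 * B₃ ^ 2) κ δ₀ :=
    kernelBound_of_analytic (geomZ d M) EX h E2 hα₂ hE₀ hB₃ han h118 hrepr hh
  have ha := delta1_latt_pos hd hM two_pos hδ₀ hκ2
  have e : ∑' X : LDom d, ∑' y, E2 X x y * w y = ∑' y, (∑' X : LDom d, E2 X x y) * w y :=
    fubini434 (E := E2) ha (fun F y => sum_abs_latt_le hd hM hC hδ₀ hκ2 hEK x y F) hKW hw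
  refine ⟨e, ?_⟩
  rw [e]
  exact chain290 hd hM EX h₀ h E2₀ E2 SF hα₂ hE₀ hB₃ hη hδ₀ hκ₀ han h118 hrepr₀ hrepr hh₀ hh hdiff h3 hSF hx
    hKW hw

/-- **The chain for the ZEROTH coefficient kernel of (4.34)** (weight `w = 1`, `p = 0`, `K_w = 1`; `S_{a,0,d} = K₁(d,a)`,
`B12MomentSums434.S_zero_eq_K₁`): `|Σ'_{X⊂□̃²} Σ_{y∈SF} 𝐄²₀(X,x,y) − Σ_{y∈ℤᵈ} Π(x,y)| ≤` the three-term bound at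
`p = 0`. [cite: Balaban1987RG1, (4.34) p.289 and p.290-291] -/
theorem chain290_moment0 (hd : 0 < d) (hM : 0 < M) (EX : LDom d → W → ℂ)
    (h₀ h : LDom d → Pt d → W) (E2₀ E2 : LDom d → Pt d → Pt d → ℝ) {S : Set (Pt d)}
    {α₂ E₀ B₃ η κ δ₀ R₀ : ℝ} {B : Set (Pt d)} (SF : Finset (Pt d))
    (hα₂ : 0 < α₂) (hE₀ : 0 ≤ E₀) (hB₃ : 0 ≤ B₃) (hη : 0 ≤ η) (hδ₀ : 0 < δ₀)
    (hκ₀ : kappa₀ (4 * 2 ^ d) (2 * d) ≤ κ / 4)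
    (han : ∀ X, AnalyticOnNhd ℂ (EX X) (ball 0 α₂))
    (h118 : ∀ X, ∀ v ∈ ball (0 : W) α₂, ‖EX X v‖ ≤ E₀ * Real.exp (-κ * treeLen X.1))
    (hrepr₀ : ∀ X x y, E2₀ X x y = (mixedDeriv (EX X) (h₀ X x) (h₀ X y)).re)
    (hrepr : ∀ X x y, E2 X x y = (mixedDeriv (EX X) (h X x) (h X y)).re)
    (hh₀ : ∀ X x, ‖h₀ X x‖ ≤ B₃ * Real.exp (-δ₀ * (geomZ d M).distD x X))
    (hh : ∀ X x, ‖h X x‖ ≤ B₃ * Real.exp (-δ₀ * (geomZ d M).distD x X))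
    (hdiff : ∀ X, ∀ x ∈ S, ‖h₀ X x - h X x‖ ≤ η * Real.exp (-δ₀ * (geomZ d M).distD x X))
    (h3 : cthickening (3 * R₀) B ⊆ ↑SF) (hSF : (↑SF : Set (Pt d)) ⊆ S) {x : Pt d} (hx : x ∈ B) :
    |∑' X : {X : LDom d // ¬ MeetsZ M (cthickening (2 * R₀) B)ᶜ X}, ∑ y ∈ SF, E2₀ X.1 x y -
        ∑' y, ∑' X : LDom d, E2 X x y| ≤
      8 * E₀ / α₂ ^ 2 * B₃ * η * Real.exp (delta1 δ₀ κ ((M : ℝ) * d) * ((M : ℝ) * d) * 3) *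
          K₀ (4 * 2 ^ d) (2 * d) * K₁ d (δ₀ / 2) * 1 * B12WholeLattice290.S (delta1 δ₀ κ ((M : ℝ) * d)) 0 d +
        4 * E₀ / α₂ ^ 2 * B₃ ^ 2 * Real.exp (delta1 δ₀ κ ((M : ℝ) * d) * ((M : ℝ) * d) * 3) *
          K₀ (4 * 2 ^ d) (2 * d) * K₁ d (δ₀ / 2) * 1 * Real.exp (-(delta1 δ₀ κ ((M : ℝ) * d) / 2) * (3 * R₀)) *
          B12WholeLattice290.S (delta1 δ₀ κ ((M : ℝ) * d) / 2) 0 d +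
        4 * E₀ / α₂ ^ 2 * B₃ ^ 2 * Real.exp (delta1 δ₀ κ ((M : ℝ) * d) * ((M : ℝ) * d) * 3) *
          K₀ (4 * 2 ^ d) (2 * d) * K₁ d (δ₀ / 4) *
          Real.exp (-(delta1 δ₀ κ ((M : ℝ) * d) / 2) * (2 * R₀ - (M : ℝ) * d * 3)) * 1 *
          B12WholeLattice290.S (delta1 δ₀ κ ((M : ℝ) * d)) 0 d := by
  have hw : ∀ y, |(fun _ : Pt d => (1 : ℝ)) y| ≤ 1 * pw 0 (x - y) := fun y => by
    rw [pw_zero_exp, abs_one, mul_one]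
  have h := chain290 hd hM EX h₀ h E2₀ E2 SF hα₂ hE₀ hB₃ hη hδ₀ hκ₀ han h118 hrepr₀ hrepr hh₀ hh hdiff h3 hSF hx
    zero_le_one hw
  simpa only [mul_one] using h

/-- **The chain for the FIRST-MOMENT coefficient kernels of (4.34)** (weight `w(y) = y_κ − x_κ`, `p = 1`,
`K_w = 1`, `B12MomentSums434.abs_coord_le_pw`): `|Σ'_{X⊂□̃²} Σ_{y∈SF} 𝐄²₀(X,x,y)(y_κ − x_κ) − Σ_{y∈ℤᵈ} Π(x,y)(y_κ − x_κ)| ≤`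
the three-term bound at `p = 1`. [cite: Balaban1987RG1, (4.34) p.289 and p.290-291] -/
theorem chain290_moment1 (hd : 0 < d) (hM : 0 < M) (EX : LDom d → W → ℂ)
    (h₀ h : LDom d → Pt d → W) (E2₀ E2 : LDom d → Pt d → Pt d → ℝ) {S : Set (Pt d)}
    {α₂ E₀ B₃ η κ δ₀ R₀ : ℝ} {B : Set (Pt d)} (SF : Finset (Pt d))
    (hα₂ : 0 < α₂) (hE₀ : 0 ≤ E₀) (hB₃ : 0 ≤ B₃) (hη : 0 ≤ η) (hδ₀ : 0 < δ₀)
    (hκ₀ : kappa₀ (4 * 2 ^ d) (2 * d) ≤ κ / 4)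
    (han : ∀ X, AnalyticOnNhd ℂ (EX X) (ball 0 α₂))
    (h118 : ∀ X, ∀ v ∈ ball (0 : W) α₂, ‖EX X v‖ ≤ E₀ * Real.exp (-κ * treeLen X.1))
    (hrepr₀ : ∀ X x y, E2₀ X x y = (mixedDeriv (EX X) (h₀ X x) (h₀ X y)).re)
    (hrepr : ∀ X x y, E2 X x y = (mixedDeriv (EX X) (h X x) (h X y)).re)
    (hh₀ : ∀ X x, ‖h₀ X x‖ ≤ B₃ * Real.exp (-δ₀ * (geomZ d M).distD x X))
    (hh : ∀ X x, ‖h X x‖ ≤ B₃ * Real.exp (-δ₀ * (geomZ d M).distD x X))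
    (hdiff : ∀ X, ∀ x ∈ S, ‖h₀ X x - h X x‖ ≤ η * Real.exp (-δ₀ * (geomZ d M).distD x X))
    (h3 : cthickening (3 * R₀) B ⊆ ↑SF) (hSF : (↑SF : Set (Pt d)) ⊆ S) {x : Pt d} (hx : x ∈ B)
    (κ' : Fin d) :
    |∑' X : {X : LDom d // ¬ MeetsZ M (cthickening (2 * R₀) B)ᶜ X},
          ∑ y ∈ SF, E2₀ X.1 x y * ((y κ' - x κ' : ℤ) : ℝ) -
        ∑' y, (∑' X : LDom d, E2 X x y) * ((y κ' - x κ' : ℤ) : ℝ)| ≤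
      8 * E₀ / α₂ ^ 2 * B₃ * η * Real.exp (delta1 δ₀ κ ((M : ℝ) * d) * ((M : ℝ) * d) * 3) *
          K₀ (4 * 2 ^ d) (2 * d) * K₁ d (δ₀ / 2) * 1 * B12WholeLattice290.S (delta1 δ₀ κ ((M : ℝ) * d)) 1 d +
        4 * E₀ / α₂ ^ 2 * B₃ ^ 2 * Real.exp (delta1 δ₀ κ ((M : ℝ) * d) * ((M : ℝ) * d) * 3) *
          K₀ (4 * 2 ^ d) (2 * d) * K₁ d (δ₀ / 2) * 1 * Real.exp (-(delta1 δ₀ κ ((M : ℝ) * d) / 2) * (3 * R₀)) *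
          B12WholeLattice290.S (delta1 δ₀ κ ((M : ℝ) * d) / 2) 1 d +
        4 * E₀ / α₂ ^ 2 * B₃ ^ 2 * Real.exp (delta1 δ₀ κ ((M : ℝ) * d) * ((M : ℝ) * d) * 3) *
          K₀ (4 * 2 ^ d) (2 * d) * K₁ d (δ₀ / 4) *
          Real.exp (-(delta1 δ₀ κ ((M : ℝ) * d) / 2) * (2 * R₀ - (M : ℝ) * d * 3)) * 1 *
          B12WholeLattice290.S (delta1 δ₀ κ ((M : ℝ) * d)) 1 d :=
  chain290 hd hM EX h₀ h E2₀ E2 SF hα₂ hE₀ hB₃ hη hδ₀ hκ₀ han h118 hrepr₀ hrepr hh₀ hh hdiff h3 hSF hx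
    zero_le_one fun y => by rw [one_mul]; exact abs_coord_le_pw κ' x y

/-- **The chain for the SECOND-MOMENT coefficient kernels of (4.34)** (weight `w(y) = (y_κ − x_κ)(y_λ − x_λ)`,
`p = 2`, `K_w = 1`, `B12MomentSums434.abs_coord2_le_pw`) — the coefficient whose Π-version is evaluated in (4.43):
`|Σ'_{X⊂□̃²} Σ_{y∈SF} 𝐄²₀(X,x,y)(y_κ − x_κ)(y_λ − x_λ) − Σ_{y∈ℤᵈ} Π(x,y)(y_κ − x_κ)(y_λ − x_λ)| ≤` the three-term
bound at `p = 2`. [cite: Balaban1987RG1, (4.34) p.289, p.290-291 and (4.43) p.291] -/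
theorem chain290_moment2 (hd : 0 < d) (hM : 0 < M) (EX : LDom d → W → ℂ)
    (h₀ h : LDom d → Pt d → W) (E2₀ E2 : LDom d → Pt d → Pt d → ℝ) {S : Set (Pt d)}
    {α₂ E₀ B₃ η κ δ₀ R₀ : ℝ} {B : Set (Pt d)} (SF : Finset (Pt d))
    (hα₂ : 0 < α₂) (hE₀ : 0 ≤ E₀) (hB₃ : 0 ≤ B₃) (hη : 0 ≤ η) (hδ₀ : 0 < δ₀)
    (hκ₀ : kappa₀ (4 * 2 ^ d) (2 * d) ≤ κ / 4)
    (han : ∀ X, AnalyticOnNhd ℂ (EX X) (ball 0 α₂))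
    (h118 : ∀ X, ∀ v ∈ ball (0 : W) α₂, ‖EX X v‖ ≤ E₀ * Real.exp (-κ * treeLen X.1))
    (hrepr₀ : ∀ X x y, E2₀ X x y = (mixedDeriv (EX X) (h₀ X x) (h₀ X y)).re)
    (hrepr : ∀ X x y, E2 X x y = (mixedDeriv (EX X) (h X x) (h X y)).re)
    (hh₀ : ∀ X x, ‖h₀ X x‖ ≤ B₃ * Real.exp (-δ₀ * (geomZ d M).distD x X))
    (hh : ∀ X x, ‖h X x‖ ≤ B₃ * Real.exp (-δ₀ * (geomZ d M).distD x X))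
    (hdiff : ∀ X, ∀ x ∈ S, ‖h₀ X x - h X x‖ ≤ η * Real.exp (-δ₀ * (geomZ d M).distD x X))
    (h3 : cthickening (3 * R₀) B ⊆ ↑SF) (hSF : (↑SF : Set (Pt d)) ⊆ S) {x : Pt d} (hx : x ∈ B)
    (κ' l : Fin d) :
    |∑' X : {X : LDom d // ¬ MeetsZ M (cthickening (2 * R₀) B)ᶜ X},
          ∑ y ∈ SF, E2₀ X.1 x y * (((y κ' - x κ' : ℤ) : ℝ) * ((y l - x l : ℤ) : ℝ)) -
        ∑' y, (∑' X : LDom d, E2 X x y) * (((y κ' - x κ' : ℤ) : ℝ) * ((y l - x l : ℤ) : ℝ))| ≤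
      8 * E₀ / α₂ ^ 2 * B₃ * η * Real.exp (delta1 δ₀ κ ((M : ℝ) * d) * ((M : ℝ) * d) * 3) *
          K₀ (4 * 2 ^ d) (2 * d) * K₁ d (δ₀ / 2) * 1 * B12WholeLattice290.S (delta1 δ₀ κ ((M : ℝ) * d)) 2 d +
        4 * E₀ / α₂ ^ 2 * B₃ ^ 2 * Real.exp (delta1 δ₀ κ ((M : ℝ) * d) * ((M : ℝ) * d) * 3) *
          K₀ (4 * 2 ^ d) (2 * d) * K₁ d (δ₀ / 2) * 1 * Real.exp (-(delta1 δ₀ κ ((M : ℝ) * d) / 2) * (3 * R₀)) *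
          B12WholeLattice290.S (delta1 δ₀ κ ((M : ℝ) * d) / 2) 2 d +
        4 * E₀ / α₂ ^ 2 * B₃ ^ 2 * Real.exp (delta1 δ₀ κ ((M : ℝ) * d) * ((M : ℝ) * d) * 3) *
          K₀ (4 * 2 ^ d) (2 * d) * K₁ d (δ₀ / 4) *
          Real.exp (-(delta1 δ₀ κ ((M : ℝ) * d) / 2) * (2 * R₀ - (M : ℝ) * d * 3)) * 1 *
          B12WholeLattice290.S (delta1 δ₀ κ ((M : ℝ) * d)) 2 d :=
  chain290 hd hM EX h₀ h E2₀ E2 SF hα₂ hE₀ hB₃ hη hδ₀ hκ₀ han h118 hrepr₀ hrepr hh₀ hh hdiff h3 hSF hx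
    zero_le_one fun y => by rw [one_mul]; exact abs_coord2_le_pw κ' l x y

/-- **The chain summed over the finite x-range `supp δB ⊂ □`** («The sums over x above are restricted to
supp δB ⊂ □»): for a finite set of sites `BF ⊆ □` and x-dependent weights `|w_x(y)| ≤ K_w pw_p(x − y)`, the
x-summed expressions differ by at most `#BF` times the three-term bound (the field factor at x, constant in y, is
not estimated here). [cite: Balaban1987RG1, (4.34) p.289 and p.290-291] -/
theorem chain290_sum (hd : 0 < d) (hM : 0 < M) (EX : LDom d → W → ℂ)
    (h₀ h : LDom d → Pt d → W) (E2₀ E2 : LDom d → Pt d → Pt d → ℝ) {S : Set (Pt d)}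
    {α₂ E₀ B₃ η κ δ₀ R₀ : ℝ} {B : Set (Pt d)} (SF : Finset (Pt d))
    (hα₂ : 0 < α₂) (hE₀ : 0 ≤ E₀) (hB₃ : 0 ≤ B₃) (hη : 0 ≤ η) (hδ₀ : 0 < δ₀)
    (hκ₀ : kappa₀ (4 * 2 ^ d) (2 * d) ≤ κ / 4)
    (han : ∀ X, AnalyticOnNhd ℂ (EX X) (ball 0 α₂))
    (h118 : ∀ X, ∀ v ∈ ball (0 : W) α₂, ‖EX X v‖ ≤ E₀ * Real.exp (-κ * treeLen X.1))
    (hrepr₀ : ∀ X x y, E2₀ X x y = (mixedDeriv (EX X) (h₀ X x) (h₀ X y)).re)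
    (hrepr : ∀ X x y, E2 X x y = (mixedDeriv (EX X) (h X x) (h X y)).re)
    (hh₀ : ∀ X x, ‖h₀ X x‖ ≤ B₃ * Real.exp (-δ₀ * (geomZ d M).distD x X))
    (hh : ∀ X x, ‖h X x‖ ≤ B₃ * Real.exp (-δ₀ * (geomZ d M).distD x X))
    (hdiff : ∀ X, ∀ x ∈ S, ‖h₀ X x - h X x‖ ≤ η * Real.exp (-δ₀ * (geomZ d M).distD x X))
    (h3 : cthickening (3 * R₀) B ⊆ ↑SF) (hSF : (↑SF : Set (Pt d)) ⊆ S) (BF : Finset (Pt d))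
    (hBF : (↑BF : Set (Pt d)) ⊆ B) {w : Pt d → Pt d → ℝ} {KW : ℝ} {p : ℕ} (hKW : 0 ≤ KW)
    (hw : ∀ x ∈ BF, ∀ y, |w x y| ≤ KW * pw p (x - y)) :
    |∑ x ∈ BF, ∑' X : {X : LDom d // ¬ MeetsZ M (cthickening (2 * R₀) B)ᶜ X}, ∑ y ∈ SF, E2₀ X.1 x y * w x y -
        ∑ x ∈ BF, ∑' y, (∑' X : LDom d, E2 X x y) * w x y| ≤
      (BF.card : ℝ) *
       (8 * E₀ / α₂ ^ 2 * B₃ * η * Real.exp (delta1 δ₀ κ ((M : ℝ) * d) * ((M : ℝ) * d) * 3) *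
          K₀ (4 * 2 ^ d) (2 * d) * K₁ d (δ₀ / 2) * KW * B12WholeLattice290.S (delta1 δ₀ κ ((M : ℝ) * d)) p d +
        4 * E₀ / α₂ ^ 2 * B₃ ^ 2 * Real.exp (delta1 δ₀ κ ((M : ℝ) * d) * ((M : ℝ) * d) * 3) *
          K₀ (4 * 2 ^ d) (2 * d) * K₁ d (δ₀ / 2) * KW * Real.exp (-(delta1 δ₀ κ ((M : ℝ) * d) / 2) * (3 * R₀)) *
          B12WholeLattice290.S (delta1 δ₀ κ ((M : ℝ) * d) / 2) p d +
        4 * E₀ / α₂ ^ 2 * B₃ ^ 2 * Real.exp (delta1 δ₀ κ ((M : ℝ) * d) * ((M : ℝ) * d) * 3) *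
          K₀ (4 * 2 ^ d) (2 * d) * K₁ d (δ₀ / 4) *
          Real.exp (-(delta1 δ₀ κ ((M : ℝ) * d) / 2) * (2 * R₀ - (M : ℝ) * d * 3)) * KW *
          B12WholeLattice290.S (delta1 δ₀ κ ((M : ℝ) * d)) p d) := by
  rw [← Finset.sum_sub_distrib]
  refine (Finset.abs_sum_le_sum_abs _ _).trans ?_
  have h : ∀ x ∈ BF,
      |∑' X : {X : LDom d // ¬ MeetsZ M (cthickening (2 * R₀) B)ᶜ X}, ∑ y ∈ SF, E2₀ X.1 x y * w x y -
          ∑' y, (∑' X : LDom d, E2 X x y) * w x y| ≤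
        8 * E₀ / α₂ ^ 2 * B₃ * η * Real.exp (delta1 δ₀ κ ((M : ℝ) * d) * ((M : ℝ) * d) * 3) *
            K₀ (4 * 2 ^ d) (2 * d) * K₁ d (δ₀ / 2) * KW * B12WholeLattice290.S (delta1 δ₀ κ ((M : ℝ) * d)) p d +
          4 * E₀ / α₂ ^ 2 * B₃ ^ 2 * Real.exp (delta1 δ₀ κ ((M : ℝ) * d) * ((M : ℝ) * d) * 3) *
            K₀ (4 * 2 ^ d) (2 * d) * K₁ d (δ₀ / 2) * KW *
            Real.exp (-(delta1 δ₀ κ ((M : ℝ) * d) / 2) * (3 * R₀)) *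
            B12WholeLattice290.S (delta1 δ₀ κ ((M : ℝ) * d) / 2) p d +
          4 * E₀ / α₂ ^ 2 * B₃ ^ 2 * Real.exp (delta1 δ₀ κ ((M : ℝ) * d) * ((M : ℝ) * d) * 3) *
            K₀ (4 * 2 ^ d) (2 * d) * K₁ d (δ₀ / 4) *
            Real.exp (-(delta1 δ₀ κ ((M : ℝ) * d) / 2) * (2 * R₀ - (M : ℝ) * d * 3)) * KW *
            B12WholeLattice290.S (delta1 δ₀ κ ((M : ℝ) * d)) p d := fun x hxF =>
    chain290 hd hM EX h₀ h E2₀ E2 SF hα₂ hE₀ hB₃ hη hδ₀ hκ₀ han h118 hrepr₀ hrepr hh₀ hh hdiff h3 hSF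
      (hBF (Finset.mem_coe.2 hxF)) hKW (hw x hxF)
  have hs := Finset.sum_le_card_nsmul BF _ _ h
  rwa [nsmul_eq_mul] at hs

end Chain

end Literature.MathematicalPhysics.QuantumFieldTheory.Balaban1983to89.B12Chain290
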